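import Summits.AnomalousDissipation.AnomalousDissipation.Theorems.SawtoothPulseCascadeK1LocalisedCascadeCanonicalStripSteps
import Summits.AnomalousDissipation.AnomalousDissipation.Theorems.SawtoothPulseCascadeK1LocalisedCascadeStripBlocksOsc
import Summits.AnomalousDissipation.AnomalousDissipation.Theorems.SawtoothPulseCascadeK1LocalisedCascadeBlockJunkOsc
import Summits.AnomalousDissipation.AnomalousDissipation.Theorems.SawtoothPulseCascadeK1LocalisedCascadeCanonicalBlocksLog

/-!
# K1loc — helper: THE STRIP STEPS ON CANONICAL BLOCKS, OSCILLATORY GRADE (generic lower cut-off, closed-form junk)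

Helper file of the prover lane on the crux `K1LocalisedCascade` (stmt-AnomalousDissipation-19491), route `SawtoothPulseCascade`
(S-B/S-C assembly seat; the LEDGER ASSEMBLY, concrete layer, Osc grade; companion of `…CanonicalStripStepsQ`).  The strip steps
of `…StripBlocksOsc` (S-V, T-H over ad-sawtooth-k1loc-p1's oscillatory window blocks) on the CANONICAL geometry (`Λ_m = Λ₀2^m`,
`Q₂^m = ⌊q_nΛ_m/q_d⌋`, generic `Q₁^m < Q₂^m` with the feed inclusion and `r_m ≤ r*`), with every per-block scalar hypothesis
DISCHARGED: block denominators `D_m ≥ D₀2^m`, `D₀ = ((Gq_d − q_n)Λ₀ − Kq_d)/q_d` (`…CanonicalBlocksLog.canon_strip_den_ge`), the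
canonical oscillatory depth of `…BlockJunkOsc`, the exact rounding allowance
`ε₀^m = A_m·2π(Λ_{m+1}G)e^{−M²/2}/(2N) + 2N/(πD_m) ≤ (A*πGηΛ₀/N)2^{m+1} + (2N/(πD₀))2^{−m}`, and the junk in the closed form
  `J = 3r*²((4/3)(A*πGηΛ₀2^{M_b}/N)² + (4/3)(2N/(πD₀))² + 8N·A*/(πD₀) + M_b(8N·A*²√(4Mδ/(πD₀)) + 8A*²Mδ/π))`,
`A* = (Kq_d + (q_n + Gq_d)Λ₀)/((Gq_d − q_n)Λ₀ − Kq_d)`, `N = N_j`, `Mδ = max(1,√(2log(1/η)))·δ_j`.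

* `strip_vstep_canonicalOsc_le` (S-V), `lowFibre_hstep_canonicalOsc_le` (T-H).

No definitions; no statement about the crux. [cite: Grafakos2014, Prop. 3.1.2 (5), Prop. 3.2.7 (3), §3.1.3] [problem: turb]
-/

-- `Summit.<Summit>.<Problem>`: single-conjunct summit, the duplicate namespace segment is deliberate.
set_option linter.dupNamespace false

noncomputable section

namespace Summit.AnomalousDissipation.AnomalousDissipation.Theorems.SawtoothPulseCascade.K1Window

open MeasureTheory Set Filter Topology UnitAddTorus Function Complex Metric
open scoped Real ENNReal
open Literature.Analysis Literature.Analysis.FunctionSpaces Literature.Analysis.FunctionSpaces.Torus Literature.Analysis.FluidPDE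
open Literature.Analysis.FluidPDE.ShearStage
open Literature.Analysis.FluidPDE.SawtoothCascade Literature.Analysis.FluidPDE.SawtoothCascade.CascadeParams
open Summit.AnomalousDissipation.AnomalousDissipation.Theorems.SawtoothPulseCascade.K1Start
open Summit.AnomalousDissipation.AnomalousDissipation.Theorems.SawtoothPulseCascade.K1Flat
open Summit.AnomalousDissipation.AnomalousDissipation.Theorems.SawtoothPulseCascade.K1Ledger.From

section Cascade

variable (P : CascadeParams)

/-! ## §1 The strip (S-V) and the low fibres (T-H) on canonical blocks -/

/-- **(S-V) ON CANONICAL BLOCKS.**  The strip `Σ'[|k₀| < K]‖𝓕a_{j+1}‖²`: the low fibres `|k₁| < Λ₀` pass exactly, the chopped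
fibres are cut into canonical blocks from the floor `Λ₀ ≥ 1` with margin `q_n/q_d`, `Kq_d + q_nΛ₀ < Gq_dΛ₀`; feed slope `(u′, v′)`
(`v′ > 0`), lower cut-offs `Q₁^m < Q₂^m` (feed inclusion, `Y ≤ Q₁^m + 1`, `r_m ≤ r*`), `M_b` blocks, rounding target `η > 0` with
`max(1,√(2log(1/η)))·δ_j < π/2`.  Then `strip ≤ Σ'[|k₁| < Λ₀]‖𝓕b_j‖² + ((√J + √(Σ'[Y ≤ |k₀| ∧ u′|k₁| ≤ v′|k₀|]‖𝓕b_j‖²))² +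
((1+γ)^{2(j+1)}/(Λ₀2^{M_b}))²)` with `J` as in the file header,
`A* = (Kq_d + (q_n + Gq_d)Λ₀)/((Gq_d − q_n)Λ₀ − Kq_d)`, `D₀ = ((Gq_d − q_n)Λ₀ − Kq_d)/q_d`. [cite: Grafakos2014, Prop. 3.1.2 (5), Prop. 3.2.7 (3), §3.1.3] -/
theorem strip_vstep_canonicalOsc_le {G : ℕ} (hγ : P.γ = G) (hδ₀ : 0 < P.δ₀) (hd : 0 < P.d) (hN₀ : 1 ≤ P.N₀)
    (hρN : 1 ≤ P.ρN) (a b : ℕ → UnitAddTorus (Fin 2) → ℝ) (has : ∀ j, IsSmooth (a j)) (h0 : a 0 = datum)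
    (hb : ∀ j, b j = a j ∘ shearMap 0 1 (amp ⟨P.U j, P.U_periodic j, P.contDiff_U (P.δ_pos hδ₀ hd j)⟩ P.γ))
    (hab : ∀ j, a (j + 1) = b j ∘ shearMap 1 0 (amp ⟨P.U j, P.U_periodic j, P.contDiff_U (P.δ_pos hδ₀ hd j)⟩ P.γ))
    (j : ℕ) {K u' v' Y qn qd Λ0 : ℕ} (hqd : 0 < qd)
    (hK : K * qd + qn * Λ0 < G * qd * Λ0) (hΛ0 : 1 ≤ Λ0)
    (Q₁ : ℕ → ℕ) (hQ : ∀ m, Q₁ m < qn * (Λ0 * 2 ^ m) / qd)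
    (hfeed : ∀ m, u' * (Λ0 * 2 ^ (m + 1)) ≤ v' * (Q₁ m + 1)) {rs : ℝ}
    (hr : ∀ m, (((Q₁ m : ℕ) : ℝ) + ((qn * (Λ0 * 2 ^ m) / qd : ℕ) : ℝ)) /
      (((qn * (Λ0 * 2 ^ m) / qd : ℕ) : ℝ) - ((Q₁ m : ℕ) : ℝ)) ≤ rs)
    (hY : ∀ m, Y ≤ Q₁ m + 1) (Mb : ℕ) {η : ℝ} (hη : 0 < η)
    (hMδ : max 1 (Real.sqrt (2 * Real.log (1 / η))) * P.δ j < π / 2) :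
    ∑' k : Fin 2 → ℤ, (if |k 0| < (K : ℤ) then (1 : ℝ) else 0) * ‖mFourierCoeff (fun x => (a (j + 1) x : ℂ)) k‖ ^ 2 ≤
      ∑' k : Fin 2 → ℤ, (if |k 1| < (Λ0 : ℤ) then (1 : ℝ) else 0) * ‖mFourierCoeff (fun x => (b j x : ℂ)) k‖ ^ 2 +
      ((Real.sqrt (3 * rs ^ 2 *
            (4 / 3 * ((((K : ℝ) * qd + ((qn : ℝ) + G * qd) * Λ0) / (((G : ℝ) * qd - qn) * Λ0 - K * qd)) * π * G * η * Λ0 /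
                P.N j * 2 ^ Mb) ^ 2 + 4 / 3 * (2 * P.N j / (π * ((((G : ℝ) * qd - qn) * Λ0 - K * qd) / qd))) ^ 2 +
              8 * P.N j * (((K : ℝ) * qd + ((qn : ℝ) + G * qd) * Λ0) / (((G : ℝ) * qd - qn) * Λ0 - K * qd)) / (π * ((((G : ℝ) * qd - qn) * Λ0 - K * qd) / qd)) +
              Mb * (8 * P.N j * (((K : ℝ) * qd + ((qn : ℝ) + G * qd) * Λ0) / (((G : ℝ) * qd - qn) * Λ0 - K * qd)) ^ 2 *
                Real.sqrt (4 * (max 1 (Real.sqrt (2 * Real.log (1 / η))) * P.δ j) / (π * ((((G : ℝ) * qd - qn) * Λ0 - K * qd) / qd))) +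
                8 * (((K : ℝ) * qd + ((qn : ℝ) + G * qd) * Λ0) / (((G : ℝ) * qd - qn) * Λ0 - K * qd)) ^ 2 * (max 1 (Real.sqrt (2 * Real.log (1 / η))) * P.δ j) / π))) +
          Real.sqrt (∑' k : Fin 2 → ℤ, (if (Y : ℤ) ≤ |k 0| ∧ (u' : ℤ) * |k 1| ≤ (v' : ℤ) * |k 0| then (1 : ℝ) else 0) *
            ‖mFourierCoeff (fun x => (b j x : ℂ)) k‖ ^ 2)) ^ 2 +
        ((1 + P.γ) ^ (2 * (j + 1)) / ((Λ0 * 2 ^ Mb : ℕ) : ℝ)) ^ 2) := by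
  -- the canonical data
  set M : ℝ := max 1 (Real.sqrt (2 * Real.log (1 / η))) with hMdef
  have hM : 1 ≤ M := (zoneDepth_facts hη).1
  have hMη : Real.exp (-(M ^ 2 / 2)) ≤ η := (zoneDepth_facts hη).2
  have hN : (0 : ℝ) < P.N j := by exact_mod_cast P.N_pos hN₀ hρN j
  have hδ : 0 < P.δ j := P.δ_pos hδ₀ hd j
  have hMδ0 : 0 < M * P.δ j := mul_pos (by linarith) hδ
  set Λb : ℕ → ℕ := fun m => Λ0 * 2 ^ m with hΛb
  set Q₂ : ℕ → ℕ := fun m => qn * (Λ0 * 2 ^ m) / qd with hQ₂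
  set A : ℕ → ℝ := fun m => (((K + Q₂ m : ℕ) : ℝ) + ((Λb m * G : ℕ) : ℝ)) /
    (((Λb m * G : ℕ) : ℝ) - ((K + Q₂ m : ℕ) : ℝ)) with hA
  set Dm : ℕ → ℝ := fun m => ((Λb m * G : ℕ) : ℝ) - ((K + Q₂ m : ℕ) : ℝ) with hDm
  set As : ℝ := ((K : ℝ) * qd + ((qn : ℝ) + G * qd) * Λ0) / (((G : ℝ) * qd - qn) * Λ0 - K * qd) with hAs
  set D₀ : ℝ := (((G : ℝ) * qd - qn) * Λ0 - K * qd) / qd with hD₀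
  have hΛge : ∀ m, 1 ≤ Λ0 * 2 ^ m := fun m => hΛ0.trans (canon_blocks_ge Λ0 m)
  have hAfacts : ∀ m, 0 < A m ∧ A m ≤ As := fun m => canon_strip_A_le hqd hK (canon_blocks_ge Λ0 m)
  have hΛQ : ∀ m, K + Q₂ m < Λb m * G := fun m => canon_strip_shift hK (canon_blocks_ge Λ0 m)
  have hqdr : (0 : ℝ) < qd := by exact_mod_cast hqd
  have hc3 : (0 : ℝ) < ((G : ℝ) * qd - qn) * Λ0 - K * qd := by
    have h1 : ((K * qd + qn * Λ0 : ℕ) : ℝ) < ((G * qd * Λ0 : ℕ) : ℝ) := by exact_mod_cast hK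
    push_cast at h1
    linarith
  have hD₀pos : 0 < D₀ := by positivity
  have hDge : ∀ m, D₀ * 2 ^ m ≤ Dm m := fun m => by
    have h := canon_strip_den_ge (G := G) hqd hK m
    have e : D₀ * 2 ^ m = (((G : ℝ) * qd - qn) * Λ0 - K * qd) * 2 ^ m / qd := by rw [hD₀]; ring
    rw [e]; exact h
  have hDpos : ∀ m, 0 < Dm m := fun m => lt_of_lt_of_le (by positivity) (hDge m)
  have hA1 : ∀ m, 1 ≤ A m := fun m => by
    have hden := canon_strip_den_pos (qn := qn) (qd := qd) hK (canon_blocks_ge Λ0 m)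
    rw [hA, one_le_div hden]
    have h1 : (0 : ℝ) ≤ ((K + Q₂ m : ℕ) : ℝ) := by positivity
    show (((Λ0 * 2 ^ m) * G : ℕ) : ℝ) - ((K + qn * (Λ0 * 2 ^ m) / qd : ℕ) : ℝ) ≤
      ((K + qn * (Λ0 * 2 ^ m) / qd : ℕ) : ℝ) + (((Λ0 * 2 ^ m) * G : ℕ) : ℝ)
    have h2 : (0 : ℝ) ≤ ((K + qn * (Λ0 * 2 ^ m) / qd : ℕ) : ℝ) := by positivity
    linarith
  set d₀ : ℕ → ℝ := fun m => 1 / (2 * π * A m * Dm m) + Real.sqrt (4 * (M * P.δ j) / (π * A m * Dm m)) +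
    M * P.δ j / (π * P.N j) with hd₀
  have hdpos : ∀ m, 0 < d₀ m := fun m => by
    have := (hAfacts m).1; have := hDpos m
    positivity
  set ε₀ : ℕ → ℝ := fun m => A m * (2 * π * ((Λb (m + 1) * G : ℕ) : ℝ) * (Real.exp (-(M ^ 2 / 2)) / (2 * P.N j))) +
    2 * P.N j / (π * Dm m) with hε₀
  have hε0 : ∀ m, 0 ≤ ε₀ m := fun m => by
    have := (hAfacts m).1.le; have := hDpos m
    positivity
  -- the multi-block step
  have hstep := tsum_strip_vstep_blocks_osc_le P hγ hδ₀ hd hN₀ hρN a b has h0 hb hab j K Λb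
    (canon_blocks_monotone Λ0) (by simpa [hΛb] using hΛ0) Mb Q₁ Q₂
    hQ hΛQ hM hMδ d₀ ε₀ hdpos
    (fun m => oscDepth_hMd (M := M) (δ := P.δ j) (hAfacts m).1 (hDpos m) hN)
    (fun m => oscDepth_hAd (hAfacts m).1 (hDpos m) hN hMδ0.le) hε0 (fun m => le_rfl) (u' := u') (v' := v') (Y := Y)
    hfeed hY
  -- the junk in closed form
  have hjunk := blockJunk_osc_sum_le (r := fun m => ((Q₁ m : ℝ) + Q₂ m) / ((Q₂ m : ℝ) - Q₁ m)) (A := A) (D := Dm) (ε₀ := ε₀)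
    (rs := rs) (As := As) (D₀ := D₀) (e₀ := As * π * G * η * Λ0 / P.N j) (b₀ := 2 * P.N j / (π * D₀)) (N := (P.N j : ℝ))
    (Mδ := M * P.δ j) hN hMδ0.le hD₀pos
    (fun m => canon_r_nonneg (hQ m)) hr hA1 (fun m => (hAfacts m).2) hDge hε0
    (by have := (hAfacts 0).1.le.trans (hAfacts 0).2; positivity) (by positivity) (fun m => ?_) Mb
  · -- assemble
    have e2N : ((2 * P.N j : ℕ) : ℝ) = 2 * (P.N j : ℝ) := by push_cast; ring
    rw [e2N] at hstep
    have e0 : Λb 0 = Λ0 := by simp [hΛb]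
    rw [e0] at hstep
    exact le_add_sq_sqrt_add_mono hstep hjunk
  · -- the rounding allowance on block `m`
    simp only [hε₀]
    have hA' := (hAfacts m).2
    have hA0' := (hAfacts m).1.le
    have eΛ : ((Λb (m + 1) * G : ℕ) : ℝ) = (Λ0 : ℝ) * 2 ^ (m + 1) * G := by
      show ((Λ0 * 2 ^ (m + 1) * G : ℕ) : ℝ) = _
      push_cast; ring
    rw [eΛ]
    have hAs0 : 0 ≤ As := hA0'.trans hA'
    have hb : 2 * P.N j / (π * Dm m) ≤ 2 * P.N j / (π * D₀) * (1 / 2) ^ m := by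
      have e : 2 * P.N j / (π * D₀) * (1 / 2) ^ m = 2 * P.N j / (π * (D₀ * 2 ^ m)) := by
        rw [one_div_pow]; field_simp
      rw [e]
      exact div_le_div_of_nonneg_left (by positivity) (by positivity) (mul_le_mul_of_nonneg_left (hDge m) Real.pi_pos.le)
    refine add_le_add ?_ hb
    calc A m * (2 * π * ((Λ0 : ℝ) * 2 ^ (m + 1) * G) * (Real.exp (-(M ^ 2 / 2)) / (2 * P.N j)))
        = A m * Real.exp (-(M ^ 2 / 2)) * (π * G * Λ0 / P.N j * 2 ^ (m + 1)) := by
          field_simp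
      _ ≤ As * η * (π * G * Λ0 / P.N j * 2 ^ (m + 1)) :=
          mul_le_mul_of_nonneg_right (mul_le_mul hA' hMη (Real.exp_nonneg _) hAs0) (by positivity)
      _ = As * π * G * η * Λ0 / P.N j * 2 ^ (m + 1) := by ring


/-- **(T-H) ON CANONICAL BLOCKS.**  The low fibres `Σ'[|k₁| < K]‖𝓕b_j‖²`: the fibres `|k₀| < Λ₀` pass exactly, the chopped
fibres `k₀` are cut into canonical blocks from the floor `Λ₀ ≥ 1` (the strip threshold of `a_j`) with margin `q_n/q_d`,
`Kq_d + q_nΛ₀ < Gq_dΛ₀`; feed = the off-cone class `Σ'[Λ₀ ≤ |k₀| ∧ u′|k₀| ≤ v′|k₁|]‖𝓕a_j‖²` (`v′ > 0`), lower cut-offs `Q₁^m < Q₂^m` with the feed inclusion,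
`Y ≤ Q₁^m + 1` and `r_m ≤ r*`, `M_b` blocks, rounding target `η > 0` with `max(1,√(2log(1/η)))·δ_j < π/2`.  Then
`T ≤ Σ'[|k₀| < Λ₀]‖𝓕a_j‖² + ((√J + √feed)² + ((1+γ)^{2j}/(Λ₀2^{M_b}))²)` with `J` as in the file header,
`A* = (Kq_d + (q_n + Gq_d)Λ₀)/((Gq_d − q_n)Λ₀ − Kq_d)`, `D₀ = ((Gq_d − q_n)Λ₀ − Kq_d)/q_d`. [cite: Grafakos2014, Prop. 3.1.2 (5), Prop. 3.2.7 (3), §3.1.3] -/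
theorem lowFibre_hstep_canonicalOsc_le {G : ℕ} (hγ : P.γ = G) (hδ₀ : 0 < P.δ₀) (hd : 0 < P.d) (hN₀ : 1 ≤ P.N₀)
    (hρN : 1 ≤ P.ρN) (a b : ℕ → UnitAddTorus (Fin 2) → ℝ) (has : ∀ j, IsSmooth (a j)) (h0 : a 0 = datum)
    (hb : ∀ j, b j = a j ∘ shearMap 0 1 (amp ⟨P.U j, P.U_periodic j, P.contDiff_U (P.δ_pos hδ₀ hd j)⟩ P.γ))
    (hab : ∀ j, a (j + 1) = b j ∘ shearMap 1 0 (amp ⟨P.U j, P.U_periodic j, P.contDiff_U (P.δ_pos hδ₀ hd j)⟩ P.γ))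
    (j : ℕ) {K u' v' qn qd Λ0 : ℕ} (hqd : 0 < qd)
    (hK : K * qd + qn * Λ0 < G * qd * Λ0) (hΛ0 : 1 ≤ Λ0)
    (Q₁ : ℕ → ℕ) (hQ : ∀ m, Q₁ m < qn * (Λ0 * 2 ^ m) / qd)
    (hfeed : ∀ m, u' * (Λ0 * 2 ^ (m + 1)) ≤ v' * (Q₁ m + 1)) {rs : ℝ}
    (hr : ∀ m, (((Q₁ m : ℕ) : ℝ) + ((qn * (Λ0 * 2 ^ m) / qd : ℕ) : ℝ)) /
      (((qn * (Λ0 * 2 ^ m) / qd : ℕ) : ℝ) - ((Q₁ m : ℕ) : ℝ)) ≤ rs)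
    (Mb : ℕ) {η : ℝ} (hη : 0 < η)
    (hMδ : max 1 (Real.sqrt (2 * Real.log (1 / η))) * P.δ j < π / 2) :
    ∑' k : Fin 2 → ℤ, (if |k 1| < (K : ℤ) then (1 : ℝ) else 0) * ‖mFourierCoeff (fun x => (b j x : ℂ)) k‖ ^ 2 ≤
      ∑' k : Fin 2 → ℤ, (if |k 0| < (Λ0 : ℤ) then (1 : ℝ) else 0) * ‖mFourierCoeff (fun x => (a j x : ℂ)) k‖ ^ 2 +
      ((Real.sqrt (3 * rs ^ 2 *
            (4 / 3 * ((((K : ℝ) * qd + ((qn : ℝ) + G * qd) * Λ0) / (((G : ℝ) * qd - qn) * Λ0 - K * qd)) * π * G * η * Λ0 /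
                P.N j * 2 ^ Mb) ^ 2 + 4 / 3 * (2 * P.N j / (π * ((((G : ℝ) * qd - qn) * Λ0 - K * qd) / qd))) ^ 2 +
              8 * P.N j * (((K : ℝ) * qd + ((qn : ℝ) + G * qd) * Λ0) / (((G : ℝ) * qd - qn) * Λ0 - K * qd)) / (π * ((((G : ℝ) * qd - qn) * Λ0 - K * qd) / qd)) +
              Mb * (8 * P.N j * (((K : ℝ) * qd + ((qn : ℝ) + G * qd) * Λ0) / (((G : ℝ) * qd - qn) * Λ0 - K * qd)) ^ 2 *
                Real.sqrt (4 * (max 1 (Real.sqrt (2 * Real.log (1 / η))) * P.δ j) / (π * ((((G : ℝ) * qd - qn) * Λ0 - K * qd) / qd))) +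
                8 * (((K : ℝ) * qd + ((qn : ℝ) + G * qd) * Λ0) / (((G : ℝ) * qd - qn) * Λ0 - K * qd)) ^ 2 * (max 1 (Real.sqrt (2 * Real.log (1 / η))) * P.δ j) / π))) +
          Real.sqrt (∑' k : Fin 2 → ℤ, (if (Λ0 : ℤ) ≤ |k 0| ∧ (u' : ℤ) * |k 0| ≤ (v' : ℤ) * |k 1| then (1 : ℝ) else 0) *
            ‖mFourierCoeff (fun x => (a j x : ℂ)) k‖ ^ 2)) ^ 2 +
        ((1 + P.γ) ^ (2 * j) / ((Λ0 * 2 ^ Mb : ℕ) : ℝ)) ^ 2) := by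
  -- the canonical data
  set M : ℝ := max 1 (Real.sqrt (2 * Real.log (1 / η))) with hMdef
  have hM : 1 ≤ M := (zoneDepth_facts hη).1
  have hMη : Real.exp (-(M ^ 2 / 2)) ≤ η := (zoneDepth_facts hη).2
  have hN : (0 : ℝ) < P.N j := by exact_mod_cast P.N_pos hN₀ hρN j
  have hδ : 0 < P.δ j := P.δ_pos hδ₀ hd j
  have hMδ0 : 0 < M * P.δ j := mul_pos (by linarith) hδ
  set Λb : ℕ → ℕ := fun m => Λ0 * 2 ^ m with hΛb
  set Q₂ : ℕ → ℕ := fun m => qn * (Λ0 * 2 ^ m) / qd with hQ₂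
  set A : ℕ → ℝ := fun m => (((K + Q₂ m : ℕ) : ℝ) + ((Λb m * G : ℕ) : ℝ)) /
    (((Λb m * G : ℕ) : ℝ) - ((K + Q₂ m : ℕ) : ℝ)) with hA
  set Dm : ℕ → ℝ := fun m => ((Λb m * G : ℕ) : ℝ) - ((K + Q₂ m : ℕ) : ℝ) with hDm
  set As : ℝ := ((K : ℝ) * qd + ((qn : ℝ) + G * qd) * Λ0) / (((G : ℝ) * qd - qn) * Λ0 - K * qd) with hAs
  set D₀ : ℝ := (((G : ℝ) * qd - qn) * Λ0 - K * qd) / qd with hD₀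
  have hΛge : ∀ m, 1 ≤ Λ0 * 2 ^ m := fun m => hΛ0.trans (canon_blocks_ge Λ0 m)
  have hAfacts : ∀ m, 0 < A m ∧ A m ≤ As := fun m => canon_strip_A_le hqd hK (canon_blocks_ge Λ0 m)
  have hΛQ : ∀ m, K + Q₂ m < Λb m * G := fun m => canon_strip_shift hK (canon_blocks_ge Λ0 m)
  have hqdr : (0 : ℝ) < qd := by exact_mod_cast hqd
  have hc3 : (0 : ℝ) < ((G : ℝ) * qd - qn) * Λ0 - K * qd := by
    have h1 : ((K * qd + qn * Λ0 : ℕ) : ℝ) < ((G * qd * Λ0 : ℕ) : ℝ) := by exact_mod_cast hK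
    push_cast at h1
    linarith
  have hD₀pos : 0 < D₀ := by positivity
  have hDge : ∀ m, D₀ * 2 ^ m ≤ Dm m := fun m => by
    have h := canon_strip_den_ge (G := G) hqd hK m
    have e : D₀ * 2 ^ m = (((G : ℝ) * qd - qn) * Λ0 - K * qd) * 2 ^ m / qd := by rw [hD₀]; ring
    rw [e]; exact h
  have hDpos : ∀ m, 0 < Dm m := fun m => lt_of_lt_of_le (by positivity) (hDge m)
  have hA1 : ∀ m, 1 ≤ A m := fun m => by
    have hden := canon_strip_den_pos (qn := qn) (qd := qd) hK (canon_blocks_ge Λ0 m)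
    rw [hA, one_le_div hden]
    have h1 : (0 : ℝ) ≤ ((K + Q₂ m : ℕ) : ℝ) := by positivity
    show (((Λ0 * 2 ^ m) * G : ℕ) : ℝ) - ((K + qn * (Λ0 * 2 ^ m) / qd : ℕ) : ℝ) ≤
      ((K + qn * (Λ0 * 2 ^ m) / qd : ℕ) : ℝ) + (((Λ0 * 2 ^ m) * G : ℕ) : ℝ)
    have h2 : (0 : ℝ) ≤ ((K + qn * (Λ0 * 2 ^ m) / qd : ℕ) : ℝ) := by positivity
    linarith
  set d₀ : ℕ → ℝ := fun m => 1 / (2 * π * A m * Dm m) + Real.sqrt (4 * (M * P.δ j) / (π * A m * Dm m)) +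
    M * P.δ j / (π * P.N j) with hd₀
  have hdpos : ∀ m, 0 < d₀ m := fun m => by
    have := (hAfacts m).1; have := hDpos m
    positivity
  set ε₀ : ℕ → ℝ := fun m => A m * (2 * π * ((Λb (m + 1) * G : ℕ) : ℝ) * (Real.exp (-(M ^ 2 / 2)) / (2 * P.N j))) +
    2 * P.N j / (π * Dm m) with hε₀
  have hε0 : ∀ m, 0 ≤ ε₀ m := fun m => by
    have := (hAfacts m).1.le; have := hDpos m
    positivity
  -- the multi-block step
  have hstep := tsum_lowFibre_hstep_blocks_osc_le P hγ hδ₀ hd hN₀ hρN a b has h0 hb hab j K Λb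
    (canon_blocks_monotone Λ0) (by simpa [hΛb] using hΛ0) Mb Q₁ Q₂
    hQ hΛQ hM hMδ d₀ ε₀ hdpos
    (fun m => oscDepth_hMd (M := M) (δ := P.δ j) (hAfacts m).1 (hDpos m) hN)
    (fun m => oscDepth_hAd (hAfacts m).1 (hDpos m) hN hMδ0.le) hε0 (fun m => le_rfl) (u' := u') (v' := v')
    hfeed
  -- the junk in closed form
  have hjunk := blockJunk_osc_sum_le (r := fun m => ((Q₁ m : ℝ) + Q₂ m) / ((Q₂ m : ℝ) - Q₁ m)) (A := A) (D := Dm) (ε₀ := ε₀)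
    (rs := rs) (As := As) (D₀ := D₀) (e₀ := As * π * G * η * Λ0 / P.N j) (b₀ := 2 * P.N j / (π * D₀)) (N := (P.N j : ℝ))
    (Mδ := M * P.δ j) hN hMδ0.le hD₀pos
    (fun m => canon_r_nonneg (hQ m)) hr hA1 (fun m => (hAfacts m).2) hDge hε0
    (by have := (hAfacts 0).1.le.trans (hAfacts 0).2; positivity) (by positivity) (fun m => ?_) Mb
  · -- assemble
    have e2N : ((2 * P.N j : ℕ) : ℝ) = 2 * (P.N j : ℝ) := by push_cast; ring
    rw [e2N] at hstep
    have e0 : Λb 0 = Λ0 := by simp [hΛb]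
    rw [e0] at hstep
    exact le_add_sq_sqrt_add_mono hstep hjunk
  · -- the rounding allowance on block `m`
    simp only [hε₀]
    have hA' := (hAfacts m).2
    have hA0' := (hAfacts m).1.le
    have eΛ : ((Λb (m + 1) * G : ℕ) : ℝ) = (Λ0 : ℝ) * 2 ^ (m + 1) * G := by
      show ((Λ0 * 2 ^ (m + 1) * G : ℕ) : ℝ) = _
      push_cast; ring
    rw [eΛ]
    have hAs0 : 0 ≤ As := hA0'.trans hA'
    have hb : 2 * P.N j / (π * Dm m) ≤ 2 * P.N j / (π * D₀) * (1 / 2) ^ m := by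
      have e : 2 * P.N j / (π * D₀) * (1 / 2) ^ m = 2 * P.N j / (π * (D₀ * 2 ^ m)) := by
        rw [one_div_pow]; field_simp
      rw [e]
      exact div_le_div_of_nonneg_left (by positivity) (by positivity) (mul_le_mul_of_nonneg_left (hDge m) Real.pi_pos.le)
    refine add_le_add ?_ hb
    calc A m * (2 * π * ((Λ0 : ℝ) * 2 ^ (m + 1) * G) * (Real.exp (-(M ^ 2 / 2)) / (2 * P.N j)))
        = A m * Real.exp (-(M ^ 2 / 2)) * (π * G * Λ0 / P.N j * 2 ^ (m + 1)) := by
          field_simp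
      _ ≤ As * η * (π * G * Λ0 / P.N j * 2 ^ (m + 1)) :=
          mul_le_mul_of_nonneg_right (mul_le_mul hA' hMη (Real.exp_nonneg _) hAs0) (by positivity)
      _ = As * π * G * η * Λ0 / P.N j * 2 ^ (m + 1) := by ring


end Cascade

end Summit.AnomalousDissipation.AnomalousDissipation.Theorems.SawtoothPulseCascade.K1Window
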